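/-
Copyright (c) 2026 the pub-hodgecm-mathlib formalisation cell (harness21).  Prover seat hodgecm-mathlib-K2E3-p24 (g2), HCML Track B «K2-LIT» ∕ h413 (`stmt-HodgeConjecture-24833`),
line «SC′-IRR-lev» (leaf (S-C′-irr) `sig_K2E3GL3TwoBlockInducedIrreducible`; lead K2E3-p24, dealer D82), brick K0 (relabelling `![0,0,1]` ∕ `lastBlockLabel 3`).  2026-09-04.
-/
import Literature.NumberTheory.Automorphic.Zelevinsky1980.MaximalParabolicOrbitFiltration   -- ★ open cell criterion + chart decomposition for `lastBlockLabel (n+2)`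
import Literature.NumberTheory.Automorphic.WhittakerSupportFinite                             -- ★ `transvectionUnit`
import HarnessLib

/-!
# K2_E3 road (h413), line «SC′-IRR-lev», brick K0 — the maximal parabolic `P₍₂,₁₎ ≤ GL₃(F)` in the labelling `![0,0,1] : Fin 3 → Fin 2`: relabelling of the
# ★ Zelevinsky1980 cell kit, the root groups, and the chart decomposition of the open orbit

Cell `pub/hodgecm-mathlib` (D-0151), Track B, seat K2E3-p24 (g2) = LEAD of line «SC′-IRR-lev» (dealer K2E3-plan D82).  `--supports stmt-HodgeConjecture-24833 --as helper`;
THEOREMS ONLY (no definition ∕ instance ∕ notation ∕ named fact ∕ `sorry`); never imports `Cruxes/…/Lines`.  COUNT-NEUTRAL (plumbing).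

THE MATHEMATICS (bookkeeping, [BernsteinZelevinsky1977, §2.1, §6–7.1]; [Zelevinsky1980, §1.1]).  The leaf (S-C′-irr) and the ★ heads it consumes (Casselman ★
`intertwiningMap_subrepresentation_parabolicIndGL_eq_zero_of_isIrreducible`, Harish-Chandra ★ `isSupercuspidal_iff_jacquetGL_holds`, Whittaker ★
`rank_whittakerFunctionals_parabolicIndGL_le_one_of_fact`) speak labellings `c : Fin n → Fin r`; the ★ Zelevinsky1980 cell kit (`MaximalParabolicOrbitFiltration`,
`MaximalParabolicOpenCellRadical`) speaks `lastBlockLabel 3 : Fin 3 → Bool`.  Both cut `GL₃` into the blocks `{0,1} < {2}`, so every subgroup ∕ subset the kit mentions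
coincides, and statements depending on the labelling only through those sets transport by `subst`.  Notation: `c₀ := ![0,0,1]`, `c₁ := ![0,1,1]`,
`P := standardParabolicGL F c₀` (`= P₍₂,₁₎`), `U := unipotentRadicalGL F c₀`, `N' := oppositeCellRadical c₀` (`= U_{P₍₁,₂₎}`), `P' := standardParabolicGL F (toDual ∘ revLabel c₀)`
(`= P₍₁,₂₎`), `w₀ := permGL Fin.revPerm`, `x_{ij}(y) := transvectionUnit i j _ y`.

* §1 subgroup identities: `P = standardParabolicGL F (lastBlockLabel 3)`, `U = unipotentRadicalGL F (lastBlockLabel 3) = unipotentRadicalGL F ![false,false,true]`,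
  `N' = oppositeCellRadical (lastBlockLabel 3) = unipotentRadicalGL F c₁`, `P' = standardParabolicGL F c₁`; the open cell `parabolicDoubleCoset c₀ w₀` and its
  closed complement `cellLT c₀ w₀ = {g | g 2 0 = 0}`.
* §2 entrywise membership criteria for `P`, `U`, `N'`, `P'` in the labelling `c₀`; `N'` is commutative.  §3 root-group elements: `x₀₁(a), x₁₀(y), swap 0 1 ∈ P`;
  `x₀₂(b), x₁₂(y) ∈ U`; `x₀₁(a), x₀₂(b) ∈ N'`; `x₁₂(y) ∈ P'`, `w₀ x₁₂(y) w₀⁻¹ = x₁₀(y)`; `n' = x₀₁(n'₀₁) · x₀₂(n'₀₂)`; the shear `x₁₂(y) (x₀₁ a · x₀₂ b) x₁₂(y)⁻¹ = x₀₁ a · x₀₂ (b - a y)`.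
* §4 **`exists_sum_smoothIndRep_swap_of_forall_toFun_eq_zero`** — the ★ chart decomposition transported to `c₀`: `f|_P = 0 ⇒ f = f₀ + (swap 0 1) · f₁`, `f_i ∈ I_open`.

HONEST LABEL: HC_CM is proved only modulo the 7 printed citations (2 remaining named inputs: hLiu418, h413) until rung 0 closes; count-neutral helper.

## Mathlib ∕ tree search
Tree (★, by name): `mem_standardParabolicGL_iff`, `mem_unipotentRadicalGL_iff_apply`, `cellLT_rev_union`, `disjoint_cellLT_parabolicDoubleCoset`, the two ★ Zelevinsky1980 files,
`transvectionUnit`, `coe_permGL_mul_mul_inv`, `permGL_mem_standardParabolicGL`.  Sister: ★ `K2E3GL2BorelRelabelEquiv` (N = 2).  Dedup: `rg "MaximalParabolicRelabel"` — none.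

## References
* [BernsteinZelevinsky1977] I. N. Bernstein, A. V. Zelevinsky, *Induced representations of reductive 𝔭-adic groups I*, Ann. Sci. ÉNS 10 (1977), §2.1, §6, §7.1.
* [Zelevinsky1980] A. V. Zelevinsky, *Induced representations of reductive 𝔭-adic groups II*, Ann. Sci. ÉNS 13 (1980), §1.1.
-/

set_option autoImplicit false
set_option linter.dupNamespace false

noncomputable section

open Matrix OrderDual

namespace Summit.HodgeConjecture.HodgeConjecture.Cruxes.H413.K2E3GL3MaximalParabolicRelabel

open Literature.NumberTheory.Automorphic Literature.NumberTheory.Automorphic.Zelevinsky1980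

variable {F : Type*} [Field F]

/-! ## §1  The blocks `{0,1} < {2}` in the two labellings: subgroup and cell identities -/

section Subgroups

/-- `lastBlockLabel 3 = ![false, false, true]`. [cite: Zelevinsky1980, §1.1] -/
theorem lastBlockLabel_three : lastBlockLabel 3 = (![false, false, true] : Fin 3 → Bool) := by
  funext i
  fin_cases i <;> rfl

/-- The two labellings order the index pairs identically (strict form). [cite: BernsteinZelevinsky1977, §2.1] -/
theorem lt_iff_lastBlockLabel_lt (i j : Fin 3) :
    (![0, 0, 1] : Fin 3 → Fin 2) j < (![0, 0, 1] : Fin 3 → Fin 2) i ↔ lastBlockLabel 3 j < lastBlockLabel 3 i := by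
  rw [lastBlockLabel_three]
  fin_cases i <;> fin_cases j <;> decide

/-- The two labellings order the index pairs identically (weak form). [cite: BernsteinZelevinsky1977, §2.1] -/
theorem le_iff_lastBlockLabel_le (i j : Fin 3) :
    (![0, 0, 1] : Fin 3 → Fin 2) j ≤ (![0, 0, 1] : Fin 3 → Fin 2) i ↔ lastBlockLabel 3 j ≤ lastBlockLabel 3 i := by
  rw [lastBlockLabel_three]
  fin_cases i <;> fin_cases j <;> decide

/-- **`P₍₂,₁₎` in the two labellings is one subgroup.** [cite: BernsteinZelevinsky1977, §2.1] -/
theorem standardParabolicGL_eq_lastBlockLabel :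
    standardParabolicGL F (![0, 0, 1] : Fin 3 → Fin 2) = standardParabolicGL F (lastBlockLabel 3) := by
  refine Subgroup.ext fun g => ?_
  rw [mem_standardParabolicGL_iff, mem_standardParabolicGL_iff]
  exact ⟨fun h i j hij => h ((lt_iff_lastBlockLabel_lt i j).2 hij), fun h i j hij => h ((lt_iff_lastBlockLabel_lt i j).1 hij)⟩

/-- **`U_Q` in the two labellings is one subgroup**: `unipotentRadicalGL F ![0,0,1] = unipotentRadicalGL F (lastBlockLabel 3)`. [cite: BernsteinZelevinsky1977, §2.1] -/
theorem unipotentRadicalGL_eq_lastBlockLabel :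
    unipotentRadicalGL F (![0, 0, 1] : Fin 3 → Fin 2) = unipotentRadicalGL F (lastBlockLabel 3) := by
  refine Subgroup.ext fun g => ?_
  rw [mem_unipotentRadicalGL_iff_apply, mem_unipotentRadicalGL_iff_apply]
  exact ⟨fun h i j hij => h i j ((le_iff_lastBlockLabel_le i j).2 hij), fun h i j hij => h i j ((le_iff_lastBlockLabel_le i j).1 hij)⟩

/-- `U_Q` in the `Bool` labelling of ★ `K2E3GL3DegenerateUnipotentTrivial` is the same subgroup. [cite: BernsteinZelevinsky1977, §2.1] -/
theorem unipotentRadicalGL_eq_bool :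
    unipotentRadicalGL F (![0, 0, 1] : Fin 3 → Fin 2) = unipotentRadicalGL F (![false, false, true] : Fin 3 → Bool) := by
  rw [unipotentRadicalGL_eq_lastBlockLabel, lastBlockLabel_three]

/-- The reversed labellings order the index pairs identically (weak form). [cite: BernsteinZelevinsky1977, §6] -/
theorem revLabel_le_iff (i j : Fin 3) :
    (⇑toDual ∘ revLabel (![0, 0, 1] : Fin 3 → Fin 2)) j ≤ (⇑toDual ∘ revLabel (![0, 0, 1] : Fin 3 → Fin 2)) i ↔
      (⇑toDual ∘ revLabel (lastBlockLabel 3)) j ≤ (⇑toDual ∘ revLabel (lastBlockLabel 3)) i := by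
  rw [lastBlockLabel_three]
  simp only [Function.comp_apply, toDual_le_toDual, revLabel_apply]
  fin_cases i <;> fin_cases j <;> decide

/-- `toDual ∘ revLabel ![0,0,1]` and `![0,1,1]` order the index pairs identically (weak form): both give the blocks `{0} < {1,2}`. [cite: BernsteinZelevinsky1977, §6] -/
theorem revLabel_le_iff_oneTwo (i j : Fin 3) :
    (⇑toDual ∘ revLabel (![0, 0, 1] : Fin 3 → Fin 2)) j ≤ (⇑toDual ∘ revLabel (![0, 0, 1] : Fin 3 → Fin 2)) i ↔
      (![0, 1, 1] : Fin 3 → Fin 2) j ≤ (![0, 1, 1] : Fin 3 → Fin 2) i := by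
  simp only [Function.comp_apply, toDual_le_toDual, revLabel_apply]
  fin_cases i <;> fin_cases j <;> decide

/-- Strict form of `revLabel_le_iff_oneTwo`. [cite: BernsteinZelevinsky1977, §6] -/
theorem revLabel_lt_iff_oneTwo (i j : Fin 3) :
    (⇑toDual ∘ revLabel (![0, 0, 1] : Fin 3 → Fin 2)) j < (⇑toDual ∘ revLabel (![0, 0, 1] : Fin 3 → Fin 2)) i ↔
      (![0, 1, 1] : Fin 3 → Fin 2) j < (![0, 1, 1] : Fin 3 → Fin 2) i := by
  simp only [Function.comp_apply, toDual_lt_toDual, revLabel_apply]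
  fin_cases i <;> fin_cases j <;> decide

/-- **`N' = U_{Q'}` in the two labellings is one subgroup**: `oppositeCellRadical ![0,0,1] = oppositeCellRadical (lastBlockLabel 3)`. [cite: BernsteinZelevinsky1977, §6] -/
theorem oppositeCellRadical_eq_lastBlockLabel :
    oppositeCellRadical (K := F) (![0, 0, 1] : Fin 3 → Fin 2) = oppositeCellRadical (K := F) (lastBlockLabel 3) := by
  refine Subgroup.ext fun g => ?_
  rw [oppositeCellRadical, oppositeCellRadical, mem_unipotentRadicalGL_iff_apply, mem_unipotentRadicalGL_iff_apply]
  exact ⟨fun h i j hij => h i j ((revLabel_le_iff i j).2 hij), fun h i j hij => h i j ((revLabel_le_iff i j).1 hij)⟩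

/-- **`N'` IS THE UNIPOTENT RADICAL `U_{P₍₁,₂₎}` OF THE OTHER MAXIMAL PARABOLIC.** [cite: BernsteinZelevinsky1977, §6] -/
theorem oppositeCellRadical_eq_unipotentRadicalGL_oneTwo :
    oppositeCellRadical (K := F) (![0, 0, 1] : Fin 3 → Fin 2) = unipotentRadicalGL F (![0, 1, 1] : Fin 3 → Fin 2) := by
  refine Subgroup.ext fun g => ?_
  rw [oppositeCellRadical, mem_unipotentRadicalGL_iff_apply, mem_unipotentRadicalGL_iff_apply]
  exact ⟨fun h i j hij => h i j ((revLabel_le_iff_oneTwo i j).2 hij), fun h i j hij => h i j ((revLabel_le_iff_oneTwo i j).1 hij)⟩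

/-- **The reversed parabolic `P'` is `P₍₁,₂₎ = standardParabolicGL F ![0,1,1]`.** [cite: BernsteinZelevinsky1977, §6] -/
theorem reversedParabolic_eq_oneTwo :
    standardParabolicGL F (⇑toDual ∘ revLabel (![0, 0, 1] : Fin 3 → Fin 2)) = standardParabolicGL F (![0, 1, 1] : Fin 3 → Fin 2) := by
  refine Subgroup.ext fun g => ?_
  rw [mem_standardParabolicGL_iff, mem_standardParabolicGL_iff]
  exact ⟨fun h i j hij => h ((revLabel_lt_iff_oneTwo i j).2 hij), fun h i j hij => h ((revLabel_lt_iff_oneTwo i j).1 hij)⟩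

/-- The open cell `P w₀ U₃` in the two labellings is one set. [cite: BernsteinZelevinsky1977, §7.1] -/
theorem parabolicDoubleCoset_eq_lastBlockLabel :
    parabolicDoubleCoset (K := F) (![0, 0, 1] : Fin 3 → Fin 2) Fin.revPerm = parabolicDoubleCoset (K := F) (lastBlockLabel 3) Fin.revPerm := by
  ext g
  rw [mem_parabolicDoubleCoset_iff, mem_parabolicDoubleCoset_iff, standardParabolicGL_eq_lastBlockLabel]

/-- `![0,0,1]` is monotone. [cite: BernsteinZelevinsky1977, §2.1] -/
theorem monotone_twoOne : Monotone (![0, 0, 1] : Fin 3 → Fin 2) := by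
  intro i j hij
  fin_cases i <;> fin_cases j <;> first | decide | exact absurd hij (by decide)

/-- `![0,1,1]` is monotone. [cite: BernsteinZelevinsky1977, §2.1] -/
theorem monotone_oneTwo : Monotone (![0, 1, 1] : Fin 3 → Fin 2) := by
  intro i j hij
  fin_cases i <;> fin_cases j <;> first | decide | exact absurd hij (by decide)

/-- The closed complement `cellLT c w₀` of the open cell in the two labellings is one set (the complement of the open cell). [cite: BernsteinZelevinsky1977, §7.1] -/
theorem cellLT_eq_lastBlockLabel :
    cellLT (K := F) (![0, 0, 1] : Fin 3 → Fin 2) Fin.revPerm = cellLT (K := F) (lastBlockLabel 3) Fin.revPerm := by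
  have key : ∀ {α : Type} [LinearOrder α] [Fintype α] (c : Fin 3 → α), Monotone c →
      cellLT (K := F) c Fin.revPerm = (parabolicDoubleCoset (K := F) c Fin.revPerm)ᶜ := by
    intro α _ _ c hc
    ext g
    have hu := Set.eq_univ_iff_forall.1 (cellLT_rev_union (K := F) c hc) g
    have hd := disjoint_cellLT_parabolicDoubleCoset (K := F) c hc Fin.revPerm
    exact ⟨fun h h' => Set.disjoint_left.1 hd h h', fun h => hu.resolve_right h⟩
  rw [key _ monotone_twoOne, key _ (monotone_lastBlockLabel 3), parabolicDoubleCoset_eq_lastBlockLabel]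

/-- **The open cell criterion**, labelling `![0,0,1]`: `g ∈ P w₀ U₃ ↔ g₂₀ ≠ 0`. [cite: BernsteinZelevinsky1977, §7.1] -/
theorem mem_parabolicDoubleCoset_iff_apply_ne_zero (g : GL (Fin 3) F) :
    g ∈ parabolicDoubleCoset (K := F) (![0, 0, 1] : Fin 3 → Fin 2) Fin.revPerm ↔ (g : Matrix (Fin 3) (Fin 3) F) 2 0 ≠ 0 := by
  rw [parabolicDoubleCoset_eq_lastBlockLabel]
  exact mem_parabolicDoubleCoset_rev_iff_apply_ne_zero (n := 1) g

/-- **The closed complement of the open cell is `{g₂₀ = 0}`**, labelling `![0,0,1]`. [cite: BernsteinZelevinsky1977, §7.1] -/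
theorem mem_cellLT_iff_apply_eq_zero (g : GL (Fin 3) F) :
    g ∈ cellLT (K := F) (![0, 0, 1] : Fin 3 → Fin 2) Fin.revPerm ↔ (g : Matrix (Fin 3) (Fin 3) F) 2 0 = 0 := by
  rw [cellLT_eq_lastBlockLabel]
  exact mem_cellLT_rev_iff_apply_eq_zero (n := 1) g

end Subgroups

/-! ## §2  Entrywise membership criteria in the labelling `![0,0,1]` -/

section Entries

/-- `g ∈ P = P₍₂,₁₎ ↔ g₂₀ = g₂₁ = 0`. [cite: BernsteinZelevinsky1977, §2.1] -/
theorem mem_standardParabolicGL_iff_entry (g : GL (Fin 3) F) :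
    g ∈ standardParabolicGL F (![0, 0, 1] : Fin 3 → Fin 2) ↔ (g : Matrix (Fin 3) (Fin 3) F) 2 0 = 0 ∧ (g : Matrix (Fin 3) (Fin 3) F) 2 1 = 0 := by
  rw [mem_standardParabolicGL_iff]
  constructor
  · intro h
    exact ⟨h (show (![0, 0, 1] : Fin 3 → Fin 2) 0 < (![0, 0, 1] : Fin 3 → Fin 2) 2 by decide),
      h (show (![0, 0, 1] : Fin 3 → Fin 2) 1 < (![0, 0, 1] : Fin 3 → Fin 2) 2 by decide)⟩
  · rintro ⟨h0, h1⟩ i j hij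
    fin_cases i <;> fin_cases j <;> first | exact absurd hij (by decide) | exact h0 | exact h1

/-- `g ∈ P' = P₍₁,₂₎ ↔ g₁₀ = g₂₀ = 0`. [cite: BernsteinZelevinsky1977, §2.1] -/
theorem mem_reversedParabolic_iff_entry (g : GL (Fin 3) F) :
    g ∈ standardParabolicGL F (⇑toDual ∘ revLabel (![0, 0, 1] : Fin 3 → Fin 2)) ↔
      (g : Matrix (Fin 3) (Fin 3) F) 1 0 = 0 ∧ (g : Matrix (Fin 3) (Fin 3) F) 2 0 = 0 := by
  rw [reversedParabolic_eq_oneTwo, mem_standardParabolicGL_iff]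
  constructor
  · intro h
    exact ⟨h (show (![0, 1, 1] : Fin 3 → Fin 2) 0 < (![0, 1, 1] : Fin 3 → Fin 2) 1 by decide),
      h (show (![0, 1, 1] : Fin 3 → Fin 2) 0 < (![0, 1, 1] : Fin 3 → Fin 2) 2 by decide)⟩
  · rintro ⟨h0, h1⟩ i j hij
    fin_cases i <;> fin_cases j <;> first | exact absurd hij (by decide) | exact h0 | exact h1

/-- `g ∈ U = U_Q ↔ g` agrees with `1` except at the entries `(0,2)`, `(1,2)`. [cite: BernsteinZelevinsky1977, §2.1] -/
theorem mem_unipotentRadicalGL_iff_entry (g : GL (Fin 3) F) :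
    g ∈ unipotentRadicalGL F (![0, 0, 1] : Fin 3 → Fin 2) ↔
      ∀ i j : Fin 3, ¬ (i ≠ 2 ∧ j = 2) → (g : Matrix (Fin 3) (Fin 3) F) i j = (1 : Matrix (Fin 3) (Fin 3) F) i j := by
  rw [mem_unipotentRadicalGL_iff_apply]
  refine forall_congr' fun i => forall_congr' fun j => ?_
  have key : ((![0, 0, 1] : Fin 3 → Fin 2) j ≤ (![0, 0, 1] : Fin 3 → Fin 2) i) ↔ ¬ (i ≠ 2 ∧ j = 2) := by
    fin_cases i <;> fin_cases j <;> decide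
  rw [key]

/-- `g ∈ N' = U_{P₍₁,₂₎} ↔ g` agrees with `1` except at the entries `(0,1)`, `(0,2)`. [cite: BernsteinZelevinsky1977, §6] -/
theorem mem_oppositeCellRadical_iff_entry (g : GL (Fin 3) F) :
    g ∈ oppositeCellRadical (K := F) (![0, 0, 1] : Fin 3 → Fin 2) ↔
      ∀ i j : Fin 3, ¬ (i = 0 ∧ j ≠ 0) → (g : Matrix (Fin 3) (Fin 3) F) i j = (1 : Matrix (Fin 3) (Fin 3) F) i j := by
  rw [oppositeCellRadical_eq_lastBlockLabel, mem_oppositeCellRadical_lastBlockLabel_iff]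
  refine forall_congr' fun i => forall_congr' fun j => ?_
  have key : ((i : ℕ) = 0 ∧ (j : ℕ) ≠ 0) ↔ (i = 0 ∧ j ≠ 0) := by
    simp only [Ne, Fin.ext_iff, Fin.val_zero]
  rw [key]

/-- **`N'` is the additive group of its first rows**: `(x y)₀ⱼ = x₀ⱼ + y₀ⱼ` for `j ≠ 0`. [cite: BernsteinZelevinsky1977, §6] -/
theorem mul_apply_zero_of_mem_oppositeCellRadical {x y : GL (Fin 3) F}
    (hx : x ∈ oppositeCellRadical (K := F) (![0, 0, 1] : Fin 3 → Fin 2)) (hy : y ∈ oppositeCellRadical (K := F) (![0, 0, 1] : Fin 3 → Fin 2))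
    {j : Fin 3} (hj : j ≠ 0) :
    ((x * y : GL (Fin 3) F) : Matrix (Fin 3) (Fin 3) F) 0 j = (x : Matrix (Fin 3) (Fin 3) F) 0 j + (y : Matrix (Fin 3) (Fin 3) F) 0 j := by
  rw [oppositeCellRadical_eq_lastBlockLabel] at hx hy
  exact Zelevinsky1980.mul_apply_zero_of_mem_oppositeCellRadical (n := 2) hx hy hj

/-- **`N'` is commutative.** [cite: BernsteinZelevinsky1977, §6] -/
theorem mul_comm_of_mem_oppositeCellRadical {x y : GL (Fin 3) F}
    (hx : x ∈ oppositeCellRadical (K := F) (![0, 0, 1] : Fin 3 → Fin 2)) (hy : y ∈ oppositeCellRadical (K := F) (![0, 0, 1] : Fin 3 → Fin 2)) :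
    x * y = y * x := by
  rw [oppositeCellRadical_eq_lastBlockLabel] at hx hy
  exact Zelevinsky1980.mul_comm_of_mem_oppositeCellRadical (n := 2) hx hy

/-- Two elements of `N'` with the same entries `(0,1)`, `(0,2)` are equal. [cite: BernsteinZelevinsky1977, §6] -/
theorem eq_of_mem_oppositeCellRadical {x y : GL (Fin 3) F}
    (hx : x ∈ oppositeCellRadical (K := F) (![0, 0, 1] : Fin 3 → Fin 2)) (hy : y ∈ oppositeCellRadical (K := F) (![0, 0, 1] : Fin 3 → Fin 2))
    (h1 : (x : Matrix (Fin 3) (Fin 3) F) 0 1 = (y : Matrix (Fin 3) (Fin 3) F) 0 1) (h2 : (x : Matrix (Fin 3) (Fin 3) F) 0 2 = (y : Matrix (Fin 3) (Fin 3) F) 0 2) :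
    x = y := by
  rw [oppositeCellRadical_eq_lastBlockLabel] at hx hy
  refine Zelevinsky1980.eq_of_mem_oppositeCellRadical_of_apply_zero_eq (n := 2) hx hy fun j hj => ?_
  fin_cases j
  · exact absurd rfl hj
  · exact h1
  · exact h2

end Entries

/-! ## §3  Root-group elements -/

section RootGroups

/-- Entries of `x_{ij}(y) = 1 + y E_{ij}`. [cite: BernsteinZelevinsky1977, §2.1] -/
theorem transvectionUnit_apply {i j : Fin 3} (hij : i ≠ j) (y : F) (a b : Fin 3) :
    ((transvectionUnit i j hij y : GL (Fin 3) F) : Matrix (Fin 3) (Fin 3) F) a b =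
      (1 : Matrix (Fin 3) (Fin 3) F) a b + if a = i ∧ b = j then y else 0 := by
  rw [coe_transvectionUnit, Matrix.add_apply, Matrix.single_apply]
  by_cases h : a = i ∧ b = j
  · rw [if_pos ⟨h.1.symm, h.2.symm⟩, if_pos h]
  · rw [if_neg (fun h' => h ⟨h'.1.symm, h'.2.symm⟩), if_neg h]

/-- `x₁₀(y) ∈ P` (it is block diagonal, inside the `GL₂` block). [cite: BernsteinZelevinsky1977, §2.1] -/
theorem transvectionUnit_one_zero_mem_standardParabolicGL (y : F) :
    (transvectionUnit 1 0 (by decide) y : GL (Fin 3) F) ∈ standardParabolicGL F (![0, 0, 1] : Fin 3 → Fin 2) := by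
  rw [mem_standardParabolicGL_iff_entry, transvectionUnit_apply, transvectionUnit_apply]
  simp

/-- `x₀₁(a) ∈ P` (inside the `GL₂` block). [cite: BernsteinZelevinsky1977, §2.1] -/
theorem transvectionUnit_zero_one_mem_standardParabolicGL (a : F) :
    (transvectionUnit 0 1 (by decide) a : GL (Fin 3) F) ∈ standardParabolicGL F (![0, 0, 1] : Fin 3 → Fin 2) := by
  rw [mem_standardParabolicGL_iff_entry, transvectionUnit_apply, transvectionUnit_apply]
  simp

/-- `x₀₂(b) ∈ U = U_Q`. [cite: BernsteinZelevinsky1977, §2.1] -/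
theorem transvectionUnit_zero_two_mem_unipotentRadicalGL (b : F) :
    (transvectionUnit 0 2 (by decide) b : GL (Fin 3) F) ∈ unipotentRadicalGL F (![0, 0, 1] : Fin 3 → Fin 2) := by
  rw [mem_unipotentRadicalGL_iff_entry]
  intro i j hij
  rw [transvectionUnit_apply]
  fin_cases i <;> fin_cases j <;> first | exact absurd (by decide) hij | simp

/-- `x₁₂(y) ∈ U = U_Q`. [cite: BernsteinZelevinsky1977, §2.1] -/
theorem transvectionUnit_one_two_mem_unipotentRadicalGL (y : F) :
    (transvectionUnit 1 2 (by decide) y : GL (Fin 3) F) ∈ unipotentRadicalGL F (![0, 0, 1] : Fin 3 → Fin 2) := by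
  rw [mem_unipotentRadicalGL_iff_entry]
  intro i j hij
  rw [transvectionUnit_apply]
  fin_cases i <;> fin_cases j <;> first | exact absurd (by decide) hij | simp

/-- `x₀₁(a) ∈ N' = U_{Q'}`. [cite: BernsteinZelevinsky1977, §6] -/
theorem transvectionUnit_zero_one_mem_oppositeCellRadical (a : F) :
    (transvectionUnit 0 1 (by decide) a : GL (Fin 3) F) ∈ oppositeCellRadical (K := F) (![0, 0, 1] : Fin 3 → Fin 2) := by
  rw [mem_oppositeCellRadical_iff_entry]
  intro i j hij
  rw [transvectionUnit_apply]
  fin_cases i <;> fin_cases j <;> first | exact absurd (by decide) hij | simp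

/-- `x₀₂(b) ∈ N' = U_{Q'}`. [cite: BernsteinZelevinsky1977, §6] -/
theorem transvectionUnit_zero_two_mem_oppositeCellRadical (b : F) :
    (transvectionUnit 0 2 (by decide) b : GL (Fin 3) F) ∈ oppositeCellRadical (K := F) (![0, 0, 1] : Fin 3 → Fin 2) := by
  rw [mem_oppositeCellRadical_iff_entry]
  intro i j hij
  rw [transvectionUnit_apply]
  fin_cases i <;> fin_cases j <;> first | exact absurd (by decide) hij | simp

/-- `x₁₂(y) ∈ P' = P₍₁,₂₎` (the reversed parabolic). [cite: BernsteinZelevinsky1977, §6] -/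
theorem transvectionUnit_one_two_mem_reversedParabolic (y : F) :
    (transvectionUnit 1 2 (by decide) y : GL (Fin 3) F) ∈ standardParabolicGL F (⇑toDual ∘ revLabel (![0, 0, 1] : Fin 3 → Fin 2)) := by
  rw [mem_reversedParabolic_iff_entry, transvectionUnit_apply, transvectionUnit_apply]
  simp

/-- **`w₀ x₁₂(y) w₀⁻¹ = x₁₀(y)`** (the root group `(1,2) ⊂ U_Q` goes to the lower root group `(1,0)` of the `GL₂` block). [cite: BernsteinZelevinsky1977, §6] -/
theorem permGL_rev_mul_transvectionUnit_one_two_mul_inv (y : F) :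
    (permGL Fin.revPerm : GL (Fin 3) F) * transvectionUnit 1 2 (by decide) y * (permGL Fin.revPerm)⁻¹ = transvectionUnit 1 0 (by decide) y := by
  apply Units.ext
  rw [coe_permGL_mul_mul_inv]
  ext a b
  rw [Matrix.submatrix_apply, transvectionUnit_apply, transvectionUnit_apply]
  fin_cases a <;> fin_cases b <;> simp [Fin.revPerm_apply]

/-- `permGL (swap 0 1) ∈ P` (the Weyl element of the `GL₂` block). [cite: BernsteinZelevinsky1977, §2.1] -/
theorem permGL_swap_zero_one_mem_standardParabolicGL :
    (permGL (Equiv.swap 0 1) : GL (Fin 3) F) ∈ standardParabolicGL F (![0, 0, 1] : Fin 3 → Fin 2) :=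
  permGL_mem_standardParabolicGL _ fun i => by fin_cases i <;> decide

/-- **Every `n' ∈ N'` is `x₀₁(n'₀₁) · x₀₂(n'₀₂)`.** [cite: BernsteinZelevinsky1977, §6] -/
theorem eq_transvectionUnit_mul_of_mem_oppositeCellRadical {n' : GL (Fin 3) F}
    (hn' : n' ∈ oppositeCellRadical (K := F) (![0, 0, 1] : Fin 3 → Fin 2)) :
    n' = transvectionUnit 0 1 (by decide) ((n' : Matrix (Fin 3) (Fin 3) F) 0 1) * transvectionUnit 0 2 (by decide) ((n' : Matrix (Fin 3) (Fin 3) F) 0 2) := by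
  have h1 := transvectionUnit_zero_one_mem_oppositeCellRadical (F := F) ((n' : Matrix (Fin 3) (Fin 3) F) 0 1)
  have h2 := transvectionUnit_zero_two_mem_oppositeCellRadical (F := F) ((n' : Matrix (Fin 3) (Fin 3) F) 0 2)
  refine eq_of_mem_oppositeCellRadical hn' (Subgroup.mul_mem _ h1 h2) ?_ ?_
  · rw [mul_apply_zero_of_mem_oppositeCellRadical h1 h2 (by decide), transvectionUnit_apply, transvectionUnit_apply]
    simp
  · rw [mul_apply_zero_of_mem_oppositeCellRadical h1 h2 (by decide), transvectionUnit_apply, transvectionUnit_apply]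
    simp

/-- **The shear** `x₁₂(y) · (x₀₁ a · x₀₂ b) · x₁₂(y)⁻¹ = x₀₁ a · x₀₂ (b - a y)` of the plane `N' ≅ F²` by the root group `(1,2) ⊂ U_Q`. [cite: BernsteinZelevinsky1977, §6] -/
theorem transvectionUnit_one_two_conj (y a b : F) :
    (transvectionUnit 1 2 (by decide) y : GL (Fin 3) F) * (transvectionUnit 0 1 (by decide) a * transvectionUnit 0 2 (by decide) b) *
        (transvectionUnit 1 2 (by decide) y)⁻¹ =
      transvectionUnit 0 1 (by decide) a * transvectionUnit 0 2 (by decide) (b - a * y) := by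
  rw [mul_inv_eq_iff_eq_mul]
  apply Units.ext
  simp only [Units.val_mul, coe_transvectionUnit]
  ext i j
  fin_cases i <;> fin_cases j <;> simp [Matrix.mul_apply, Fin.sum_univ_three, Matrix.one_apply, Matrix.single_apply]

end RootGroups

/-! ## §4  The chart decomposition of the open `P`-orbit, transported to the labelling `![0,0,1]` -/

section Chart

variable [ValuativeRel F] [TopologicalSpace F] [IsNonarchimedeanLocalField F] {W : Type*} [AddCommGroup W] [Module ℂ W]

/-- Transport device: the ★ chart decomposition (for `lastBlockLabel 3`) depends on the labelling only through `P` and `cellLT`, so it holds for any subgroup and set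
EQUAL to those. [cite: BernsteinZelevinsky1977, §7.1] -/
theorem exists_sum_smoothIndRep_swap_of_eq {P : Subgroup (GL (Fin 3) F)} (hP : P = standardParabolicGL F (lastBlockLabel 3))
    {Z : Set (GL (Fin 3) F)} (hZ : Z = cellLT (K := F) (lastBlockLabel 3) Fin.revPerm)
    (σ' : Representation ℂ ↥P W) (f : Representation.SmoothInd P σ') (hf : ∀ p ∈ P, f.toFun p = 0) :
    ∃ fi : Fin 2 → Representation.SmoothInd P σ', (∀ i, fi i ∈ vanishingOn P σ' Z) ∧
      f = ∑ i, Representation.smoothIndRep P σ' (permGL (Equiv.swap 0 (Fin.castSucc i))) (fi i) := by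
  subst hP hZ
  exact Zelevinsky1980.exists_sum_smoothIndRep_swap_of_forall_toFun_eq_zero (n := 1) σ' f hf

/-- **THE CHART DECOMPOSITION OF THE OPEN `P`-ORBIT, labelling `![0,0,1]`.**  Every `f ∈ Ind_P^{GL₃} σ'` (`P = P₍₂,₁₎`) vanishing on `P` is `f₀ + (swap 0 1) · f₁`
with `f₀`, `f₁` vanishing off the open cell `P w₀ U₃` (on `cellLT ![0,0,1] w₀ = {g₂₀ = 0}`); `swap 0 1` lies in the Levi. [cite: BernsteinZelevinsky1977, §7.1] -/
theorem exists_sum_smoothIndRep_swap_of_forall_toFun_eq_zero (σ' : Representation ℂ ↥(standardParabolicGL F (![0, 0, 1] : Fin 3 → Fin 2)) W)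
    (f : Representation.SmoothInd (standardParabolicGL F (![0, 0, 1] : Fin 3 → Fin 2)) σ')
    (hf : ∀ p ∈ standardParabolicGL F (![0, 0, 1] : Fin 3 → Fin 2), f.toFun p = 0) :
    ∃ fi : Fin 2 → Representation.SmoothInd (standardParabolicGL F (![0, 0, 1] : Fin 3 → Fin 2)) σ',
      (∀ i, fi i ∈ vanishingOn (standardParabolicGL F (![0, 0, 1] : Fin 3 → Fin 2)) σ' (cellLT (K := F) (![0, 0, 1] : Fin 3 → Fin 2) Fin.revPerm)) ∧
      f = ∑ i, Representation.smoothIndRep (standardParabolicGL F (![0, 0, 1] : Fin 3 → Fin 2)) σ' (permGL (Equiv.swap 0 (Fin.castSucc i))) (fi i) :=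
  exists_sum_smoothIndRep_swap_of_eq standardParabolicGL_eq_lastBlockLabel cellLT_eq_lastBlockLabel σ' f hf

omit [ValuativeRel F] [IsNonarchimedeanLocalField F] in
/-- A section of `Ind_P σ'` vanishes on `P` iff it vanishes at `1` (`f(p) = σ'(p) f(1)`). [cite: BernsteinZelevinsky1977, §2.3] -/
theorem forall_toFun_eq_zero_iff_toFun_one [SeparatelyContinuousMul (GL (Fin 3) F)] {P : Subgroup (GL (Fin 3) F)} (σ' : Representation ℂ ↥P W)
    (f : Representation.SmoothInd P σ') :
    (∀ p ∈ P, f.toFun p = 0) ↔ f.toFun 1 = 0 := by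
  refine ⟨fun h => h 1 (Subgroup.one_mem _), fun h p hp => ?_⟩
  have := Representation.SmoothInd.toFun_subgroup_mul f ⟨p, hp⟩ 1
  rw [mul_one] at this
  rw [this, h, map_zero]

end Chart

end Summit.HodgeConjecture.HodgeConjecture.Cruxes.H413.K2E3GL3MaximalParabolicRelabel

end
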